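import Mathlib
import HarnessLib
import Summits.ResolutionOfSingularities.ResolutionOfSingularities.Theorems.WildQuotientsWildQuotientResolutionS1aKillFreeFix
import Summits.ResolutionOfSingularities.ResolutionOfSingularities.Theorems.WildQuotientsWildQuotientResolutionS1aKillTightRing

/-!
# S1a — K-FREE FRAME, (F-T9)/(F-T9′): PRINCIPALITY CERTIFICATES — `u ∈ D(c)`, `β̃·(e c)^k ∈ aug`, `aug ≤ (β̃)` ⇒ `PrincipalNear u`

[OURS · L1 W4.5c · lead-1 g12; plan-1 A-KF v1 §2.2 «(F-T9) PRINCIPALITY CERTIFICATE (to land, ≈ 40–60 lines). Data: node data D on (O, B) with an EX-DIV element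
β̃ ∈ B such that aug σ_B ≤ (β̃); c ∈ Γ(V, O) ARBITRARY (not necessarily invariant); u ∈ V.basicOpen c; (e c)^k·β̃ ∈ aug σ_B. Conclusion: D.PrincipalNear u.
Proof: if g₀u = u, b := Π_{g∈G} actO g c is invariant, of degree 0, with u ∈ D(b) and (e b)^k β̃ ∈ aug, so `map_augmentationIdeal_away_eq_span` gives
aug·B_b = (β̃); if g₀u ≠ u, (F-T5)»; (F-T9′) = the case β̃ = 1 (plain root chart); RULING R-F15 (4)] — NOT statements of the manuscript; counted 0; AI-level
work, weaker than expert review. Crux stmt-ResolutionOfSingularities-17941 `CyclicQuotientFourfolds`, line `s1a-logminvertex` v12 (`stub_reachLowerInF`).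

* `fixed_of_fixed_of_mem_zpowers` — a `g₀`-fixed point is fixed by all of `G = ⟨g₀⟩`; `mem_basicOpen_norm_of_fixed` — at a `G`-fixed point `u ∈ D(c)`,
  `u ∈ D(Π_g g·c)`; `norm_invariant`, `dvd_norm`;
* ★ `NodeData.principalNear_of_certificate` — (F-T9); ★ `NodeData.principalNear_of_certificate_one` — (F-T9′) (`β̃ = 1`: `(e c)^k ∈ aug`);
* `NodeData.principalNear_of_coverCertificate` — a finite COVER CERTIFICATE `{(c_l, k_l)}` makes every point of the chart off `V(c_1, …, c_m)` principal;
  `NodeAtlasData.fLocus_inter_subset_zeroLocus` — hence `F_𝔄 ∩ O_i ⊆ V(c's)` for the chart `i` of an atlas (the X-scheme's UPPER BOUND on `F`, A-KF v1 (S3)).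
-/

set_option linter.dupNamespace false

noncomputable section

universe u

open CategoryTheory Limits AlgebraicGeometry TopologicalSpace Topology
open Literature.AlgebraicGeometry.Resolution Literature.AlgebraicGeometry.RelativeSpec
open Summit.ResolutionOfSingularities.ResolutionOfSingularities.Theorems.WildQuotientResolution.S1
open Summit.ResolutionOfSingularities.ResolutionOfSingularities.Theorems.WildQuotientResolution.S1.NodeAtlas
open Summit.ResolutionOfSingularities.ResolutionOfSingularities.Theorems.WildQuotientResolution.S1.GoodCharts

namespace Summit.ResolutionOfSingularities.ResolutionOfSingularities.Theorems.WildQuotientResolution.S1.NpFrame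

section Norm

variable {V Y : Scheme.{u}} {r : V ⟶ Y} {G : Type u} [Group G] (ρ : ActionOver r G) (O : ρ.StableAffineOpens) {g₀ : G}

/-- The action on points is multiplicative: `(g h)·u = g·(h·u)`. -/
theorem aut_mul_base (g h : G) (u : V) : (ρ.aut (g * h)).hom.base u = (ρ.aut g).hom.base ((ρ.aut h).hom.base u) := by
  rw [← Scheme.Hom.comp_apply, ← Iso.trans_hom, ← Aut.Aut_mul_def, ← map_mul]

/-- **A `g₀`-fixed point is fixed by every element of `G = ⟨g₀⟩`.** -/
theorem fixed_of_fixed_of_mem_zpowers (hG : ∀ g : G, g ∈ Subgroup.zpowers g₀) {u : V} (hfix : (ρ.aut g₀).hom.base u = u) (g : G) :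
    (ρ.aut g).hom.base u = u := by
  let H : Subgroup G :=
    { carrier := {g | (ρ.aut g).hom.base u = u}
      mul_mem' := fun {a b} ha hb => by
        change (ρ.aut (a * b)).hom.base u = u
        rw [aut_mul_base, hb, ha]
      one_mem' := by
        change (ρ.aut 1).hom.base u = u
        rw [map_one]; rfl
      inv_mem' := fun {a} ha => by
        change (ρ.aut a⁻¹).hom.base u = u
        conv_lhs => rw [← ha]
        rw [← aut_mul_base, inv_mul_cancel, map_one]; rfl }
  have hle : Subgroup.zpowers g₀ ≤ H := Subgroup.zpowers_le.mpr hfix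
  exact hle (hG g)

/-- The norm `Π_g g·c` is invariant. -/
theorem norm_invariant [Fintype G] (c : Γ(V, O.1)) (g : G) : actO ρ O g (∏ h : G, actO ρ O h c) = ∏ h : G, actO ρ O h c := by
  rw [map_prod]
  simp_rw [actO_actO]
  exact Fintype.prod_equiv (Equiv.mulLeft g) _ _ fun h => rfl

/-- `c` divides its norm. -/
theorem dvd_norm [Fintype G] (c : Γ(V, O.1)) : c ∣ ∏ h : G, actO ρ O h c := by
  have h1 : actO ρ O 1 c ∣ ∏ g : G, actO ρ O g c := Finset.dvd_prod_of_mem _ (Finset.mem_univ (1 : G))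
  rwa [actO_one] at h1

/-- **At a `G`-fixed point `u ∈ D(c)`, `u ∈ D(Π_g g·c)`** (every translate of `c` is invertible at `u`). -/
theorem mem_basicOpen_norm_of_fixed [Fintype G] {u : V} (hu : u ∈ O.1) (hfix : ∀ g : G, (ρ.aut g).hom.base u = u) (c : Γ(V, O.1))
    (huc : u ∈ V.basicOpen c) : u ∈ V.basicOpen (∏ g : G, actO ρ O g c) := by
  rw [V.mem_basicOpen _ u hu, map_prod]
  refine Finset.prod_induction _ IsUnit (fun _ _ => IsUnit.mul) isUnit_one fun g _ => ?_
  rw [← V.mem_basicOpen _ u hu, mem_basicOpen_actO_iff ρ O g c u hu, hfix g⁻¹]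
  exact huc

end Norm

/-! ## (F-T9) / (F-T9′) -/

section Cert

variable {p : ℕ} {V Y : Scheme.{u}} {q : V ⟶ Y} {G : Type u} [Group G] {ρ : ActionOver q G} {g₀ : G} {O : ρ.StableAffineOpens}

/-- The composite `Γ(V, O) ≃ 𝒜 0 ⊆ B` of node data, as a ring hom. -/
theorem NodeData.exists_ringHom_coe_e (D : NodeData p ρ g₀ O) :
    letI := D.instCommRing; letI := D.instGradedRing
    ∃ φ : Γ(V, O.1) →+* D.B, ∀ t, φ t = ((D.e t : ↥(D.𝒜 0)) : D.B) := by
  letI := D.instCommRing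
  letI := D.instGradedRing
  exact ⟨(SetLike.GradeZero.subring D.𝒜).subtype.comp (D.e : Γ(V, O.1) →+* ↥(D.𝒜 0)), fun _ => rfl⟩

/-- ★ **(F-T9) PRINCIPALITY CERTIFICATE.** Node data `D` on `(O, B)` with `β̃ ∈ B` such that `aug σ ≤ (β̃)`; `c ∈ Γ(V, O)` ARBITRARY with `u ∈ D(c)` and
`β̃ · (e c)^k ∈ aug σ`. Then `D` is principal near `u`: at a `g₀`-fixed `u` the NORM `b = Π_g g·c` is invariant with `u ∈ D(b)`, `c ∣ b`, so
`β̃ (e b)^k ∈ aug` and `aug · B_{e b} = (β̃)` (`map_augmentationIdeal_away_eq_span`); at a non-fixed `u`, (F-T5). [OURS · L1 W4.5c · A-KF v1 §2.2 (F-T9)] -/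
theorem NodeData.principalNear_of_certificate [Finite G] (hG : ∀ g : G, g ∈ Subgroup.zpowers g₀) (D : NodeData p ρ g₀ O)
    (β : D.B) (hFD1 : letI := D.instCommRing; augmentationIdeal D.σ ≤ Ideal.span {β})
    (c : Γ(V, O.1)) {u : V} (huc : u ∈ V.basicOpen c) {k : ℕ}
    (hk : letI := D.instCommRing; letI := D.instGradedRing; β * ((D.e c : ↥(D.𝒜 0)) : D.B) ^ k ∈ augmentationIdeal D.σ) :
    D.PrincipalNear u := by
  classical
  letI := D.instCommRing
  letI := D.instGradedRing
  letI := Fintype.ofFinite G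
  have hu : u ∈ O.1 := V.basicOpen_le c huc
  by_cases hfix : (ρ.aut g₀).hom.base u = u
  · obtain ⟨φ, hφ⟩ := D.exists_ringHom_coe_e
    let b : Γ(V, O.1) := ∏ g : G, actO ρ O g c
    have hub : u ∈ V.basicOpen b := mem_basicOpen_norm_of_fixed ρ O hu (fixed_of_fixed_of_mem_zpowers ρ hG hfix) c huc
    have hkb : β * ((D.e b : ↥(D.𝒜 0)) : D.B) ^ k ∈ augmentationIdeal D.σ := by
      rw [← hφ] at hk ⊢
      have hdvd : β * φ c ^ k ∣ β * φ b ^ k := mul_dvd_mul_left β (pow_dvd_pow_of_dvd (map_dvd φ (dvd_norm ρ O c)) k)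
      exact Ideal.mem_of_dvd _ hdvd hk
    refine ⟨b, norm_invariant ρ O c, hub, ?_⟩
    rw [KillCert.map_augmentationIdeal_away_eq_span (σ := D.σ) (β := β) (b := ((D.e b : ↥(D.𝒜 0)) : D.B)) hFD1 hkb]
    exact ⟨⟨algebraMap _ _ β, by rw [Ideal.submodule_span_eq]⟩⟩
  · exact D.principalNear_of_not_fixed hG hu hfix

/-- ★ **(F-T9′) PRINCIPALITY CERTIFICATE, plain form** (`β̃ = 1`, e.g. the plain root chart): `u ∈ D(c)` and `(e c)^k ∈ aug σ` ⇒ `D` principal near `u`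
(indeed `aug · B_{e b} = (1)` with `b` the norm of `c`). [OURS · L1 W4.5c · A-KF v1 §2.2 (F-T9′)] -/
theorem NodeData.principalNear_of_certificate_one [Finite G] (hG : ∀ g : G, g ∈ Subgroup.zpowers g₀) (D : NodeData p ρ g₀ O)
    (c : Γ(V, O.1)) {u : V} (huc : u ∈ V.basicOpen c) {k : ℕ}
    (hk : letI := D.instCommRing; letI := D.instGradedRing; ((D.e c : ↥(D.𝒜 0)) : D.B) ^ k ∈ augmentationIdeal D.σ) :
    D.PrincipalNear u := by
  letI := D.instCommRing
  letI := D.instGradedRing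
  refine D.principalNear_of_certificate hG 1 (by rw [Ideal.span_singleton_one]; exact le_top) c huc (k := k) ?_
  rw [one_mul]; exact hk

/-- **COVER CERTIFICATE ⇒ principal off `V(c_1, …, c_m)`.** A family of certificates `(c_l, k_l)` for node data `D` with `aug σ ≤ (β̃)` makes `D`
principal near every point of the chart outside the common zero locus of the `c_l`. [OURS · L1 W4.5c · A-KF v1 §2.2 «cover certificate»] -/
theorem NodeData.principalNear_of_coverCertificate [Finite G] (hG : ∀ g : G, g ∈ Subgroup.zpowers g₀) (D : NodeData p ρ g₀ O)
    (β : D.B) (hFD1 : letI := D.instCommRing; augmentationIdeal D.σ ≤ Ideal.span {β})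
    {ℓ : Type*} (c : ℓ → Γ(V, O.1)) (k : ℓ → ℕ)
    (hk : ∀ l, letI := D.instCommRing; letI := D.instGradedRing; β * ((D.e (c l) : ↥(D.𝒜 0)) : D.B) ^ k l ∈ augmentationIdeal D.σ)
    {u : V} (hV : u ∉ V.zeroLocus (U := O.1) (Set.range c)) : D.PrincipalNear u := by
  rw [Scheme.mem_zeroLocus_iff] at hV
  push Not at hV
  obtain ⟨_, ⟨l, rfl⟩, hl⟩ := hV
  exact D.principalNear_of_certificate hG β hFD1 (c l) hl (hk l)

/-- **The X-scheme's UPPER BOUND on `F`** (A-KF v1 (S3)): for an atlas `𝔄` whose chart `i` carries a cover certificate `(c_l, k_l)`,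
`F_𝔄 ∩ O_i ⊆ V(c_1, …, c_m)`. [OURS · L1 W4.5c · A-KF v1 §2.1–2.2] -/
theorem NodeAtlasData.fLocus_inter_subset_zeroLocus [Finite G] (hG : ∀ g : G, g ∈ Subgroup.zpowers g₀) (𝔄 : NodeAtlasData p ρ g₀) (i : 𝔄.ι)
    (β : (𝔄.D i).B) (hFD1 : letI := (𝔄.D i).instCommRing; augmentationIdeal (𝔄.D i).σ ≤ Ideal.span {β})
    {ℓ : Type*} (c : ℓ → Γ(V, (𝔄.O i).1)) (k : ℓ → ℕ)
    (hk : ∀ l, letI := (𝔄.D i).instCommRing; letI := (𝔄.D i).instGradedRing;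
      β * (((𝔄.D i).e (c l) : ↥((𝔄.D i).𝒜 0)) : (𝔄.D i).B) ^ k l ∈ augmentationIdeal (𝔄.D i).σ) :
    𝔄.fLocus ∩ ((𝔄.O i).1 : Set V) ⊆ V.zeroLocus (U := (𝔄.O i).1) (Set.range c) := by
  rintro u ⟨huF, hui⟩
  by_contra hV
  exact huF i hui ((𝔄.D i).principalNear_of_coverCertificate hG β hFD1 c k hk hV)

/-- The same bound with NO unknown part: if moreover `F_𝔄 ⊆ O_i` (e.g. a one-chart atlas), then `F_𝔄 ⊆ V(c_1, …, c_m)`. -/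
theorem NodeAtlasData.fLocus_subset_zeroLocus [Finite G] (hG : ∀ g : G, g ∈ Subgroup.zpowers g₀) (𝔄 : NodeAtlasData p ρ g₀) (i : 𝔄.ι)
    (hO : 𝔄.fLocus ⊆ ((𝔄.O i).1 : Set V))
    (β : (𝔄.D i).B) (hFD1 : letI := (𝔄.D i).instCommRing; augmentationIdeal (𝔄.D i).σ ≤ Ideal.span {β})
    {ℓ : Type*} (c : ℓ → Γ(V, (𝔄.O i).1)) (k : ℓ → ℕ)
    (hk : ∀ l, letI := (𝔄.D i).instCommRing; letI := (𝔄.D i).instGradedRing;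
      β * (((𝔄.D i).e (c l) : ↥((𝔄.D i).𝒜 0)) : (𝔄.D i).B) ^ k l ∈ augmentationIdeal (𝔄.D i).σ) :
    𝔄.fLocus ⊆ V.zeroLocus (U := (𝔄.O i).1) (Set.range c) :=
  fun _ hu => 𝔄.fLocus_inter_subset_zeroLocus hG i β hFD1 c k hk ⟨hu, hO hu⟩

end Cert

end Summit.ResolutionOfSingularities.ResolutionOfSingularities.Theorems.WildQuotientResolution.S1.NpFrame

end
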